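import Summits.BirchSwinnertonDyer.BirchSwinnertonDyer.Theses.ShadowIsolation

/-!
# BirchSwinnertonDyer / ShadowIsolation — assembly item `Assembly` (stmt-BirchSwinnertonDyer-15493)

`Assembly : ShadowIsolationThesis → PrimeSupplyIrreducible → BirchSwinnertonDyer`: the target `X` (at every
good ordinary `p ≥ 5` with `E[p]` irreducible, `corank Ш[p^∞] = 0 ∧ corank Sel_{p^∞} = r_an`, for globally
minimal models) and the irreducible prime supply give the Statement. Proof = the tail of the route's certified
deciding theorem `closes`, verbatim: pass to a global minimal model `C • W`
(`WeierstrassCurve.hasGlobalMinimalModel_rat_holds`), take the prime from the supply, apply `X`, conclude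
`rank = r_an` on `C • W` by Greenberg's identity (`selmerCorank_eq_mordellWeilRank_add_holds`), and transport
rank (AEC III.3.1(b), `VariableChange.finrank_point_variableChange`) and analytic rank (local Euler factors are
isomorphism invariants, AEC VII.1.3(b), VII.2, App. C §16, re-derived inline as (T2)–(T3)) back along `C`.
Candidate prepared and landed by lead c3 of crux stmt-BirchSwinnertonDyer-15277 (an earlier candidate by lead c2
is attached to the item as evidence). Only import: the route file; axioms `propext`/`Classical.choice`/`Quot.sound`.
-/

-- D-0017: single-problem summit, so `Summit.BirchSwinnertonDyer.BirchSwinnertonDyer.…` repeats a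
-- namespace BY DESIGN.
set_option linter.dupNamespace false

namespace Summit.BirchSwinnertonDyer.BirchSwinnertonDyer.Theorems

open scoped BigOperators Topology Classical
open Filter Set Function
open Literature
open Summit.BirchSwinnertonDyer.BirchSwinnertonDyer.Theses.ShadowIsolation

/-- **`Assembly` (stmt-BirchSwinnertonDyer-15493).** `ShadowIsolationThesis → PrimeSupplyIrreducible →
BirchSwinnertonDyer`: for an arbitrary elliptic `W/ℚ` take a global minimal model `C • W` and a good ordinary
prime `p ≥ 5` with `E[p]` irreducible (supply); `X` there gives `corank Ш[p^∞] = 0` and `corank Sel_{p^∞} = r_an`,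
Greenberg's identity gives `rank (C • W) = r_an (C • W)`, and rank / analytic rank are invariant under `C`
(Silverman, *AEC*, III.3.1(b); VII.1.3(b), VII.2, App. C §16). [cite: Greenberg1999LNM, §1 pp. 54–57]
[cite: SilvermanAEC2009, III.3.1(b), VII.1.3(b) and C.16] -/
theorem shadowIsolation_assembly_proof :
    Summit.BirchSwinnertonDyer.BirchSwinnertonDyer.Theses.ShadowIsolation.Assembly := by
  classical
  intro hT hPS
  -- Greenberg's corank identity `corank Sel_{p^∞} = rank + corank Ш[p^∞]`, discharged in tree
  have hId : ∀ (W : WeierstrassCurve ℚ) [W.IsElliptic] (p : ℕ) [Fact p.Prime],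
      W.selmerCorank p = W.mordellWeilRank + W.shaCorank p :=
    fun W _ p _ => W.selmerCorank_eq_mordellWeilRank_add_holds p
  -- (T1) the Mordell–Weil rank is an isomorphism invariant (AEC III.3.1(b); `VariableChangePoints`)
  have hMW : ∀ (W : WeierstrassCurve ℚ) (C : WeierstrassCurve.VariableChange ℚ),
      (C • W).mordellWeilRank = W.mordellWeilRank := fun W C =>
    @WeierstrassCurve.VariableChange.finrank_point_variableChange ℚ _ W C (Classical.decEq ℚ)
  -- (T2) the local Euler factor over the fraction field of a DVR is an isomorphism invariant
  -- (AEC VII.1.3(b), VII.2, VII.5.1, App. C §16), as in route SelmerRank's certified `closes`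
  have hloc : ∀ (R : Type) [CommRing R] [IsDomain R] [IsDiscreteValuationRing R]
      (K : Type) [Field K] [Algebra R K] [IsFractionRing R K]
      (W : WeierstrassCurve K) [W.IsElliptic] (C : WeierstrassCurve.VariableChange K),
      (C • W).localEulerFactor R = W.localEulerFactor R := by
    intro R _ _ _ K _ _ _ W _ C
    obtain ⟨D, hD⟩ : ∃ D : WeierstrassCurve.VariableChange K,
        (C • W).minimal R = D • W.minimal R :=
      ⟨((C • W).exists_isMinimal R).choose * C * ((W.exists_isMinimal R).choose)⁻¹, by
        rw [WeierstrassCurve.minimal, WeierstrassCurve.minimal, mul_smul, mul_smul, inv_smul_smul]⟩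
    haveI hE : (W.minimal R).IsElliptic := by rw [WeierstrassCurve.minimal]; infer_instance
    have hΔ : (W.minimal R).Δ ≠ 0 := (W.minimal R).isUnit_Δ.ne_zero
    have hgood : ((C • W).minimal R).HasGoodReduction R ↔ (W.minimal R).HasGoodReduction R := by
      rw [WeierstrassCurve.hasGoodReduction_iff, WeierstrassCurve.hasGoodReduction_iff,
        WeierstrassCurve.valuation_Δ_eq_of_isMinimal_of_eq_smul R hD]
      exact and_congr_left' ⟨fun _ => inferInstance, fun _ => inferInstance⟩
    have hcard : Nat.card (((C • W).minimal R).reduction R).toAffine.Point =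
        Nat.card ((W.minimal R).reduction R).toAffine.Point := by
      obtain ⟨E, hE⟩ := WeierstrassCurve.exists_reduction_eq_smul R hD hΔ
      rw [hE]
      exact WeierstrassCurve.natCard_point_smul _ _
    have hpoly : (C • W).localPolynomial R = W.localPolynomial R := by
      classical
      unfold WeierstrassCurve.localPolynomial
      simp only [hgood, hcard,
        WeierstrassCurve.hasSplitMultiplicativeReduction_iff_of_isMinimal_of_eq_smul R hD hΔ,
        WeierstrassCurve.hasMultiplicativeReduction_iff_of_isMinimal_of_eq_smul R hD hΔ]
    simp only [WeierstrassCurve.localEulerFactor, WeierstrassCurve.localPowerSeries, hpoly]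
  -- (T3) hence the analytic rank `ord_{s=1} L(E,s)` is an isomorphism invariant (AEC App. C §16)
  have hAn : ∀ (W : WeierstrassCurve ℚ) [W.IsElliptic] (C : WeierstrassCurve.VariableChange ℚ),
      (C • W).analyticRank = W.analyticRank := by
    intro W _ C
    have hL : (C • W).LFunction = W.LFunction := by
      unfold WeierstrassCurve.LFunction
      congr 1
      funext v
      simp only [WeierstrassCurve.baseChange, ← WeierstrassCurve.map_variableChange]
      exact hloc _ _ _ _
    have hLS : (C • W).LSeries = W.LSeries := by
      funext s
      simp only [WeierstrassCurve.LSeries, hL]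
    have hEC : (C • W).entireContinuations = W.entireContinuations := by
      simp only [WeierstrassCurve.entireContinuations, hLS]
    have hEL : (C • W).entireLFunction = W.entireLFunction := by
      unfold WeierstrassCurve.entireLFunction
      rw [hEC, hLS]
    simp only [WeierstrassCurve.analyticRank, hEL]
  -- ASSEMBLY WITHOUT `R`: pass to a global minimal model `C • W`, take a good ordinary prime `p ≥ 5`
  -- with `E[p]` IRREDUCIBLE from the hypothesis `hPS : PrimeSupplyIrreducible` (item 15491),
  -- apply X there, conclude by Greenberg's identity and transport back along `C`
  intro W hW
  obtain ⟨C, hC⟩ := WeierstrassCurve.hasGlobalMinimalModel_rat_holds W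
  obtain ⟨p, hp, h5, hgood, hord, hirr⟩ := hPS (C • W)
  have h2 : (C • W).selmerCorank p = (C • W).mordellWeilRank + (C • W).shaCorank p := hId (C • W) p
  have h6 := hMW W C
  have h7 := hAn W C
  obtain ⟨hsha, hsel⟩ := hT (C • W) p h5 hgood hord hirr
  omega


end Summit.BirchSwinnertonDyer.BirchSwinnertonDyer.Theorems
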